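import Summits.CriticalPhenomena.PercolationContinuityZ3.Theorems.PercNearOneGluingNoHeavyLowerTailFKHullPortDeltaN
import Summits.CriticalPhenomena.PercolationContinuityZ3.Theorems.PercNearOneGluingNoHeavyLowerTailHullPortTACond
import HarnessLib

/-!
# FK sub-lane: rigid states of the hull-port functionals for `φ_{𝐩,q}` (sure cluster of `X`: vdBHK Lemma 2.3 factorisation)

Support file (`--supports stmt-CriticalPhenomena-4575`), FK sub-lane `prim-bschramm-fk-2` (gen 3); builds on p205010 (kernel theorem,
internal audit signed; external expert review pending).  No definitions, no named facts, no sorries; standard axioms.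

Part 3 (rigid states) of the Lean proof of THE LOCATED OPEN LEMMA OF THE FK FINITE LEG (lane VERDICT V40: "(Δ) = Lemma Δ_N for FK: Cov_{φ(·|C_y ∌ s,x)}(Ψ_{s,y,U}(C_x), ω_e) ≤ 0
for e = xv at x"), in the sum-level vocabulary of `…FKHullPortTADefs.lean` and for an avoided vertex SET `X` (bschramm/FK-Q2.md §12):
for `q ≥ 1`, a weight vector `w` whose weight-`1` pairs lie inside `X` (they encode earlier contractions), and a pair `e = s(a,b)`
touching `X` (`a ∈ X`) with `0 < w e < 1`,
  `B(w[e↦1], X∪{b}) · b(w[e↦0], X) ≤ B(w[e↦0], X) · b(w[e↦1], X∪{b})`,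
where `(w[e↦1], X∪{b})` is the honest contraction `G/e` and `(w[e↦0], X)` the deletion `G∖e`; i.e. contracting an edge at the avoided
set lowers `E[Ψ(C_X) | C_y ∌ s, C_y ∩ X = ∅]`.  The q = 1 proof (prim-hp-7 HP7-MDLX-PROOF §4, prove-5 `HullPort.deltaN_nonneg`) couples
`K₁ = K₀ ∪ C_v` on ONE product measure; for `q > 1` that coupling leaves a cross-measure term (FK-Q2 §11.3 (IIa)).  The FK proof uses NO
coupling: a SECOND one-edge Bernstein deformation at another fractional pair `f` touching `X` makes the claim a quadratic in `w f` whose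
endpoint coefficients and whose `B·b` cross factor are instances of the claim at smaller states, and whose other cross factor is the positive
correlation of `ω_e, ω_f` given avoidance (van den Berg–Häggström–Kahn Thm 2.1 for `φ_{𝐩,q}`); the single-fractional-pair case is prim-hp-7's
Lemma `P_v` for `φ_{𝐩,q}` after a Markov factorisation (vdBHK Lemma 2.3) and a constant tilt `q⁻¹`.

THIS FILE: when every non-loop pair touching `X` has parameter `0` or `1` (weight-1 pairs inside `X`), a configuration of nonzero weight has
no open pair leaving `X`, the open edge cluster of `X` is the fixed set of weight-1 pairs (`FK.setCl_eq_of_ne_zero`), and every sum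
`Σ_ω w_q(ω) G(ω ∖ B_X)` factorises as `Z · E_{φ_{G−B_X,q}}[G]` (`FK.sum_rigid_factor`, from the tree's `rc_sum_setCl_eq`); hence closed
forms `FK.taB_rigid`, `FK.tab_rigid`, `FK.taa_rigid`, `FK.taB_insert_rigid` of the functionals as `Z ×` world quantities of `H = G − B_X`.
[cite: VandenbergHaggstromKahn2005, Thm. 2.1 (p. 9); §1 pp. 3–5; §2.1 Lemmas 2.2–2.3 (p. 10)]
[cite: Grimmett2006, §1.4 eq. (1.20) (p. 15); Thm. (3.1)(a) (p. 37); Thm. (3.8)(b)]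
-/

noncomputable section

namespace Summit.CriticalPhenomena.PercolationContinuityZ3.Theorems.FK

open MeasureTheory Set Literature.Probability.LatticeModels Literature.Probability.Percolation
open Literature.Probability.Percolation.DecisionTree (ind ind_of_mem ind_of_not_mem ind_nonneg)
open Literature.Probability.Percolation.BHK2006 (rcMass delW)
open Summit.CriticalPhenomena.PercolationContinuityZ3.Theorems.HullPort (cut avoidEv)
open scoped Classical

variable {V : Type*} [Fintype V]

section Rigid

open Literature.Probability.Percolation.BHK2006 (weight rcMass_nonneg coe_delW setCl barOf mem_setCl_iff mem_barOf_iff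
  rc_sum_setCl_eq sum_rcMass)
open Summit.CriticalPhenomena.PercolationContinuityZ3.Theorems.HullPort (insert_mem_avoidEv_iff cut_insert_edge edge_mem_cut
  eq_of_reachable_of_isolated mem_cut_of_mem cut_insert_vertex cut_empty mem_of_reachable_of_noBoundary
  not_mem_of_reachable_of_noBoundary cut_eq_of_noBoundary reachable_sdiff_iff_of_noBoundary sum_weight_resample
  avoidEv_insert_insert_eq ind_inter_compl)

omit [Fintype V] in
/-- Deleting nothing. [folklore] -/
theorem delW_empty (w : Sym2 V → unitInterval) : delW w (∅ : Set (Sym2 V)) = w := by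
  funext e; unfold delW; rw [if_neg (Set.notMem_empty e)]

omit [Fintype V] in
/-- Deleting in two stages. [cite: VandenbergHaggstromKahn2005, §2.1 Lemma 2.3 (p. 10)] -/
theorem delW_delW (w : Sym2 V → unitInterval) (A B : Set (Sym2 V)) : delW (delW w A) B = delW w (A ∪ B) := by
  funext e; unfold delW
  by_cases hB : e ∈ B
  · rw [if_pos hB, if_pos (Set.mem_union_right _ hB)]
  · rw [if_neg hB]
    by_cases hA : e ∈ A
    · rw [if_pos hA, if_pos (Set.mem_union_left _ hA)]
    · rw [if_neg hA, if_neg (fun h => h.elim hA hB)]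

/-- `wE w B φ` only depends on `delW w B`: `wE (delW w B) ∅ = wE w B`. [cite: VandenbergHaggstromKahn2005, §2.1 Lemma 2.3 (p. 10)] -/
theorem wE_delW_empty (w : Sym2 V → unitInterval) (q : ℝ) (B : Set (Sym2 V)) (φ : Set (Sym2 V) → ℝ) :
    wE (delW w B) q ∅ φ = wE w q B φ := by
  unfold wE; rw [delW_empty]

/-! ### Rigid states: every pair touching `X` has parameter `0` or `1` -/

/-- In a rigid state, a configuration of nonzero weight has no open pair joining `X` to its complement.
[cite: Grimmett2006, §1.4 eq. (1.20) (p. 15)] -/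
theorem noBoundary_of_ne_zero {w : Sym2 V → unitInterval} {q : ℝ} {X : Set V}
    (hR : ∀ p : Sym2 V, ¬ p.IsDiag → (∃ u ∈ p, u ∈ X) → ((w p : unitInterval) : ℝ) = 0 ∨ ((w p : unitInterval) : ℝ) = 1)
    (hINV : ∀ p : Sym2 V, ((w p : unitInterval) : ℝ) = 1 → ∀ u ∈ p, u ∈ X)
    {ω : BondConfig V} (hne : rcWeightW w q ∅ ω ≠ 0) :
    ∀ p ∈ ω, ¬ p.IsDiag → ∀ a ∈ p, ∀ b ∈ p, a ∈ X → b ∈ X := by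
  intro p hp hd a ha b hb haX
  rcases hR p hd ⟨a, ha, haX⟩ with h0 | h1
  · exact absurd (rcWeightW_eq_zero_of_zero_mem w q ∅ h0 hp) hne
  · exact hINV p h1 b hb

/-- In a rigid state, on a configuration of nonzero weight the pairs touching `X` are open iff they have parameter `1`.
[cite: Grimmett2006, §1.4 eq. (1.20) (p. 15)] -/
theorem mem_iff_of_ne_zero {w : Sym2 V → unitInterval} {q : ℝ} {X : Set V}
    (hR : ∀ p : Sym2 V, ¬ p.IsDiag → (∃ u ∈ p, u ∈ X) → ((w p : unitInterval) : ℝ) = 0 ∨ ((w p : unitInterval) : ℝ) = 1)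
    {ω : BondConfig V} (hne : rcWeightW w q ∅ ω ≠ 0) {p : Sym2 V} (hd : ¬ p.IsDiag) (hp : ∃ u ∈ p, u ∈ X) :
    p ∈ ω ↔ ((w p : unitInterval) : ℝ) = 1 := by
  rcases hR p hd hp with h0 | h1
  · constructor
    · intro hpω; exact absurd (rcWeightW_eq_zero_of_zero_mem w q ∅ h0 hpω) hne
    · intro h; rw [h0] at h; exact absurd h zero_ne_one
  · constructor
    · intro _; exact h1
    · intro _; by_contra hpω; exact hne (rcWeightW_eq_zero_of_one_not_mem w q ∅ h1 hpω)

/-- In a rigid state, on a configuration of nonzero weight the open edge cluster of `X` is the set of non-loop weight-`1` pairs.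
[cite: VandenbergHaggstromKahn2005, §2.1 p. 9 (definition of `C_S`)] -/
theorem setCl_eq_of_ne_zero {w : Sym2 V → unitInterval} {q : ℝ} {X : Set V}
    (hR : ∀ p : Sym2 V, ¬ p.IsDiag → (∃ u ∈ p, u ∈ X) → ((w p : unitInterval) : ℝ) = 0 ∨ ((w p : unitInterval) : ℝ) = 1)
    (hINV : ∀ p : Sym2 V, ((w p : unitInterval) : ℝ) = 1 → ∀ u ∈ p, u ∈ X)
    {ω : BondConfig V} (hne : rcWeightW w q ∅ ω ≠ 0) :
    setCl ω X = {p : Sym2 V | ((w p : unitInterval) : ℝ) = 1 ∧ ¬ p.IsDiag} := by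
  have hζ := noBoundary_of_ne_zero (q := q) hR hINV hne
  ext p
  rw [mem_setCl_iff]
  constructor
  · rintro ⟨x, hxX, hpC⟩
    rw [mem_openEdgeCluster_iff] at hpC
    obtain ⟨hpω, hpd, hreach⟩ := hpC
    induction p using Sym2.ind with
    | h u v =>
      have hu : u ∈ X := mem_of_reachable_of_noBoundary hζ hxX (hreach u (Sym2.mem_mk_left u v))
      exact ⟨(mem_iff_of_ne_zero hR hne hpd ⟨u, Sym2.mem_mk_left u v, hu⟩).1 hpω, hpd⟩
  · rintro ⟨h1, hpd⟩
    induction p using Sym2.ind with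
    | h u v =>
      have hu : u ∈ X := hINV _ h1 u (Sym2.mem_mk_left u v)
      have hpω : s(u, v) ∈ ω := (mem_iff_of_ne_zero hR hne hpd ⟨u, Sym2.mem_mk_left u v, hu⟩).2 h1
      have huv : u ≠ v := fun h => hpd (Sym2.mk_isDiag_iff.2 h)
      refine ⟨u, hu, ?_⟩
      rw [mem_openEdgeCluster_iff]
      refine ⟨hpω, hpd, fun z hz => ?_⟩
      rcases Sym2.mem_iff.1 hz with rfl | rfl
      · exact SimpleGraph.Reachable.refl _
      · exact SimpleGraph.Adj.reachable ((openGraph_adj ω _ _).2 ⟨hpω, huv⟩)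

omit [Fintype V] in
/-- With all weight-`1` pairs inside `X`, the pairs meeting `X ∪ V(W₁)` (`W₁` = non-loop weight-`1` pairs) are the pairs meeting `X`.
[cite: VandenbergHaggstromKahn2005, §1 p. 8 (definition of `W̄`)] -/
theorem barOf_weightOne_eq {w : Sym2 V → unitInterval} {X : Set V}
    (hINV : ∀ p : Sym2 V, ((w p : unitInterval) : ℝ) = 1 → ∀ u ∈ p, u ∈ X) :
    barOf X {p : Sym2 V | ((w p : unitInterval) : ℝ) = 1 ∧ ¬ p.IsDiag} = {p : Sym2 V | ∃ u ∈ p, u ∈ X} := by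
  ext p
  rw [mem_barOf_iff]
  constructor
  · rintro ⟨v, hvp, hv | ⟨e', he', hve'⟩⟩
    · exact ⟨v, hvp, hv⟩
    · exact ⟨v, hvp, hINV e' he'.1 v hve'⟩
  · rintro ⟨u, hup, huX⟩
    exact ⟨u, hup, Or.inl huX⟩

/-- **Factorisation in a rigid state** (van den Berg–Häggström–Kahn's Lemma 2.3 for `φ_{𝐩,q}` with a sure cluster): if every pair
touching `X` has parameter `0` or `1` (weight-`1` pairs inside `X`), then for every `G`,
`Σ_ω w_q(ω) G(ω ∖ B_X) = Z · E_{φ_{G − B_X, q}}[G]`, `B_X` = the pairs meeting `X`. [cite: VandenbergHaggstromKahn2005, §2.1 Lemma 2.3 (p. 10)] -/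
theorem sum_rigid_factor (w : Sym2 V → unitInterval) {q : ℝ} (hq : 0 < q) {X : Set V}
    (hR : ∀ p : Sym2 V, ¬ p.IsDiag → (∃ u ∈ p, u ∈ X) → ((w p : unitInterval) : ℝ) = 0 ∨ ((w p : unitInterval) : ℝ) = 1)
    (hINV : ∀ p : Sym2 V, ((w p : unitInterval) : ℝ) = 1 → ∀ u ∈ p, u ∈ X) (G : Set (Sym2 V) → ℝ) :
    ∑ ω, rcWeightW w q ∅ ω * G (ω \ {p : Sym2 V | ∃ u ∈ p, u ∈ X}) =
      rcPartitionFunctionW w q ∅ * wE w q {p : Sym2 V | ∃ u ∈ p, u ∈ X} G := by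
  classical
  set W₁ : Set (Sym2 V) := {p : Sym2 V | ((w p : unitInterval) : ℝ) = 1 ∧ ¬ p.IsDiag} with hW₁
  set B : Set (Sym2 V) := {p : Sym2 V | ∃ u ∈ p, u ∈ X} with hB
  have hbar : barOf X W₁ = B := barOf_weightOne_eq hINV
  have hsupp : ∀ ω, rcWeightW w q ∅ ω ≠ 0 → setCl ω X = W₁ := fun ω hne => setCl_eq_of_ne_zero hR hINV hne
  have e1 : ∑ ω, rcWeightW w q ∅ ω * G (ω \ B) =
      ∑ ω, (if setCl ω X = W₁ then rcWeightW w q ∅ ω * G (ω \ barOf X W₁) else 0) := by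
    refine Finset.sum_congr rfl fun ω _ => ?_
    by_cases h : setCl ω X = W₁
    · rw [if_pos h, hbar]
    · have : rcWeightW w q ∅ ω = 0 := by by_contra hne; exact h (hsupp ω hne)
      rw [if_neg h, this, zero_mul]
  have e2 : ∑ ω, (if setCl ω X = W₁ then rcWeightW w q ∅ ω else 0) = rcPartitionFunctionW w q ∅ := by
    unfold rcPartitionFunctionW
    refine Finset.sum_congr rfl fun ω _ => ?_
    by_cases h : setCl ω X = W₁
    · rw [if_pos h]
    · have : rcWeightW w q ∅ ω = 0 := by by_contra hne; exact h (hsupp ω hne)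
      rw [if_neg h, this]
  rw [e1, rc_sum_setCl_eq w hq X W₁ G, e2, hbar]
  rfl

/-! ### The functionals in a rigid state -/

/-- In a rigid state (root `s ∉ X`), `B(w, X) = Z · c_H`, `c_H` the covariance in the world `G − B_X`.
[cite: VandenbergHaggstromKahn2005, §2.1 Lemma 2.3 (p. 10)] -/
theorem taB_rigid (w : Sym2 V → unitInterval) (q : ℝ) {X : Set V} {s : V} (y : V) (hsX : s ∉ X)
    (hR : ∀ p : Sym2 V, ¬ p.IsDiag → (∃ u ∈ p, u ∈ X) → ((w p : unitInterval) : ℝ) = 0 ∨ ((w p : unitInterval) : ℝ) = 1)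
    (hINV : ∀ p : Sym2 V, ((w p : unitInterval) : ℝ) = 1 → ∀ u ∈ p, u ∈ X) (g : Set (Sym2 V) → ℝ) :
    taB w q s y X g = rcPartitionFunctionW w q ∅ *
      (wE w q {p : Sym2 V | ∃ u ∈ p, u ∈ X} (fun η => g (openEdgeCluster η s) * ind (openConn s y) η) -
        wE w q {p : Sym2 V | ∃ u ∈ p, u ∈ X} (fun η => g (openEdgeCluster η s)) *
          wE w q {p : Sym2 V | ∃ u ∈ p, u ∈ X} (ind (openConn s y))) := by
  unfold taB rcPartitionFunctionW
  rw [Finset.sum_mul]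
  refine Finset.sum_congr rfl fun ω _ => ?_
  by_cases hne : rcWeightW w q ∅ ω = 0
  · rw [hne, zero_mul, zero_mul]
  · have hζ := noBoundary_of_ne_zero (q := q) hR hINV hne
    have hcut : cut X ω = {p : Sym2 V | ∃ u ∈ p, u ∈ X} := cut_eq_of_noBoundary hζ
    have hav : ω ∈ avoidEv s X := fun t ht hst => (not_mem_of_reachable_of_noBoundary hζ hsX hst) ht
    rw [ind_of_mem hav, one_mul]
    unfold taC
    rw [hcut]

/-- In a rigid state (`s, y ∉ X`), `b(w, X) = Z · φ_{G − B_X}(s ↮ y)`. [cite: VandenbergHaggstromKahn2005, §2.1 Lemma 2.3 (p. 10)] -/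
theorem tab_rigid (w : Sym2 V → unitInterval) {q : ℝ} (hq : 0 < q) {X : Set V} {s y : V} (hyX : y ∉ X)
    (hR : ∀ p : Sym2 V, ¬ p.IsDiag → (∃ u ∈ p, u ∈ X) → ((w p : unitInterval) : ℝ) = 0 ∨ ((w p : unitInterval) : ℝ) = 1)
    (hINV : ∀ p : Sym2 V, ((w p : unitInterval) : ℝ) = 1 → ∀ u ∈ p, u ∈ X) :
    tab w q s y X = rcPartitionFunctionW w q ∅ * wE w q {p : Sym2 V | ∃ u ∈ p, u ∈ X} (ind (openConn s y : Set (BondConfig V))ᶜ) := by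
  rw [← sum_rigid_factor w hq hR hINV]
  unfold tab
  refine Finset.sum_congr rfl fun ω _ => ?_
  by_cases hne : rcWeightW w q ∅ ω = 0
  · rw [hne, zero_mul, zero_mul]
  · have hζ := noBoundary_of_ne_zero (q := q) hR hINV hne
    congr 1
    have hiff : ω ∈ avoidEv y (insert s X) ↔ ω \ {p : Sym2 V | ∃ u ∈ p, u ∈ X} ∈ (openConn s y : Set (BondConfig V))ᶜ := by
      constructor
      · intro h hsy'
        exact h s (Set.mem_insert _ _) (((reachable_sdiff_iff_of_noBoundary hζ hyX s).1 hsy'.symm))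
      · intro h t ht hyt
        rcases Set.mem_insert_iff.1 ht with rfl | htX
        · exact h ((reachable_sdiff_iff_of_noBoundary hζ hyX t).2 hyt).symm
        · exact (not_mem_of_reachable_of_noBoundary hζ hyX hyt) htX
    by_cases h : ω ∈ avoidEv y (insert s X)
    · rw [ind_of_mem h, ind_of_mem (hiff.1 h)]
    · rw [ind_of_not_mem h, ind_of_not_mem (fun h' => h (hiff.2 h'))]

/-- In a rigid state (`s, y, z ∉ X`), `a(w, X) = Z · φ_{G − B_X}(s ↮ y, y ↔ z)`. [cite: VandenbergHaggstromKahn2005, §2.1 Lemma 2.3 (p. 10)] -/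
theorem taa_rigid (w : Sym2 V → unitInterval) {q : ℝ} (hq : 0 < q) {X : Set V} {s y z : V} (hyX : y ∉ X)
    (hR : ∀ p : Sym2 V, ¬ p.IsDiag → (∃ u ∈ p, u ∈ X) → ((w p : unitInterval) : ℝ) = 0 ∨ ((w p : unitInterval) : ℝ) = 1)
    (hINV : ∀ p : Sym2 V, ((w p : unitInterval) : ℝ) = 1 → ∀ u ∈ p, u ∈ X) :
    taa w q s y z X = rcPartitionFunctionW w q ∅ *
      wE w q {p : Sym2 V | ∃ u ∈ p, u ∈ X} (ind ((openConn s y : Set (BondConfig V))ᶜ ∩ openConn y z)) := by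
  rw [← sum_rigid_factor w hq hR hINV]
  unfold taa
  refine Finset.sum_congr rfl fun ω _ => ?_
  by_cases hne : rcWeightW w q ∅ ω = 0
  · rw [hne, zero_mul, zero_mul]
  · have hζ := noBoundary_of_ne_zero (q := q) hR hINV hne
    congr 1
    have hiff : ω ∈ avoidEv y (insert s X) ∩ openConn y z ↔
        ω \ {p : Sym2 V | ∃ u ∈ p, u ∈ X} ∈ (openConn s y : Set (BondConfig V))ᶜ ∩ openConn y z := by
      constructor
      · rintro ⟨h, hyz⟩
        refine ⟨fun hsy' => h s (Set.mem_insert _ _) ((reachable_sdiff_iff_of_noBoundary hζ hyX s).1 hsy'.symm), ?_⟩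
        exact (reachable_sdiff_iff_of_noBoundary hζ hyX z).2 hyz
      · rintro ⟨h, hyz⟩
        refine ⟨fun t ht hyt => ?_, (reachable_sdiff_iff_of_noBoundary hζ hyX z).1 hyz⟩
        rcases Set.mem_insert_iff.1 ht with rfl | htX
        · exact h ((reachable_sdiff_iff_of_noBoundary hζ hyX t).2 hyt).symm
        · exact (not_mem_of_reachable_of_noBoundary hζ hyX hyt) htX
    by_cases h : ω ∈ avoidEv y (insert s X) ∩ openConn y z
    · rw [ind_of_mem h, ind_of_mem (hiff.1 h)]
    · rw [ind_of_not_mem h, ind_of_not_mem (fun h' => h (hiff.2 h'))]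

/-- In a rigid state, with `b ∉ X` and `s ∉ X`: `B(w, X ∪ {b}) = Z · E_{φ_H}[1{s ↮ b} c(H − cut_b)]` for the world `H = G − B_X`, i.e.
`Z · B(w_H, {b}) / Z_H`. [cite: VandenbergHaggstromKahn2005, §2.1 Lemma 2.3 (p. 10)] -/
theorem taB_insert_rigid (w : Sym2 V → unitInterval) {q : ℝ} (hq : 0 < q) {X : Set V} {s b : V} (y : V) (hsX : s ∉ X)
    (hbX : b ∉ X)
    (hR : ∀ p : Sym2 V, ¬ p.IsDiag → (∃ u ∈ p, u ∈ X) → ((w p : unitInterval) : ℝ) = 0 ∨ ((w p : unitInterval) : ℝ) = 1)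
    (hINV : ∀ p : Sym2 V, ((w p : unitInterval) : ℝ) = 1 → ∀ u ∈ p, u ∈ X) (g : Set (Sym2 V) → ℝ) :
    taB w q s y (insert b X) g = rcPartitionFunctionW w q ∅ *
      wE w q {p : Sym2 V | ∃ u ∈ p, u ∈ X}
        (fun η => ind (avoidEv s {b}) η * taC (delW w {p : Sym2 V | ∃ u ∈ p, u ∈ X}) q s y {b} g η) := by
  rw [← sum_rigid_factor w hq hR hINV]
  unfold taB
  refine Finset.sum_congr rfl fun ω _ => ?_
  by_cases hne : rcWeightW w q ∅ ω = 0
  · rw [hne, zero_mul, zero_mul]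
  · have hζ := noBoundary_of_ne_zero (q := q) hR hINV hne
    set B : Set (Sym2 V) := {p : Sym2 V | ∃ u ∈ p, u ∈ X} with hB
    have hcutX : cut X ω = B := cut_eq_of_noBoundary hζ
    congr 1
    have hav : ind (avoidEv s (insert b X)) ω = ind (avoidEv s {b}) (ω \ B) := by
      have hiff : ω ∈ avoidEv s (insert b X) ↔ ω \ B ∈ avoidEv s {b} := by
        constructor
        · intro h t ht hst
          rw [Set.mem_singleton_iff] at ht; subst ht
          exact h t (Set.mem_insert _ _) ((reachable_sdiff_iff_of_noBoundary hζ hsX t).1 hst)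
        · intro h t ht hst
          rcases Set.mem_insert_iff.1 ht with rfl | htX
          · exact h t (Set.mem_singleton _) ((reachable_sdiff_iff_of_noBoundary hζ hsX t).2 hst)
          · exact (not_mem_of_reachable_of_noBoundary hζ hsX hst) htX
      by_cases h : ω ∈ avoidEv s (insert b X)
      · rw [ind_of_mem h, ind_of_mem (hiff.1 h)]
      · rw [ind_of_not_mem h, ind_of_not_mem (fun h' => h (hiff.2 h'))]
    have hC : taC w q s y (insert b X) g ω = taC (delW w B) q s y {b} g (ω \ B) := by
      unfold taC wE
      rw [cut_insert_vertex X b ω, hcutX, delW_delW]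
    rw [hav, hC]

end Rigid

end Summit.CriticalPhenomena.PercolationContinuityZ3.Theorems.FK

end
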